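import Literature.LinearAlgebra.RootSystem.AffineWeylGroupPoincareSeriesClosedForm
import Mathlib.Algebra.Polynomial.Reverse
import HarnessLib

/-!
# The numerator `Σ_{w∈W} t^{a(w)-n(w)}` of Iwahori–Matsumoto's Proposition 1.30 is self-reciprocal; the `Max` form of the proposition
# (Iwahori–Matsumoto 1965 §1.10, p. 257)

N. Iwahori, H. Matsumoto, *On some Bruhat decomposition and the structure of the Hecke rings of p-adic Chevalley groups*, Publ. Math. IHÉS
25 (1965) 5–48 [IwahoriMatsumoto1965] (held `paper:doi-10-1007-bf02684396`, PDF p. 22 = journal p. 257), §1.10, immediately after Proposition 1.30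
(`P(DW, t) = P(W, t) Σ_{w∈W} t^{a(w)-n(w)} / Π_{i=1}^{l} (1 - t^{a_i})`, `Σ_{α∈Δ⁺} α = Σ_i a_i α_i`, `a(w) = Σ_{α_i ∈ Π ∩ w⁻¹Δ⁻} a_i`, `n(w) =
|Δ⁺ ∩ w⁻¹Δ⁻|`): «Similarly, using `Max λ(T(d)w)` we get `P(DW, t) = P(W, t)/Π_{i=1}^{l}(1 - t^{a_i}) · t^{…} Σ_{w∈W} t^{b(w)+n(w)}` where
`b(w) = Σ_{α_i ∈ Π ∩ w⁻¹Δ⁺} a_i`. Hence `a(w) + b(w) = a_1 + ⋯ + a_l`. `a(w_Δ w) = b(w)`, `n(w_Δ w) = |Δ⁺| - n(w)`. We note that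
`Σ_{w∈W} t^{a(w)-n(w)}` is self-reciprocal: `(a(w) - n(w)) + (a(w_Δ w) - n(w_Δ w)) = Σ_i a_i - |Δ⁺|`.» (`w_Δ` is the longest element of `W`; the
power of `t` in front of `Σ_w t^{b(w)+n(w)}` is illegible in the held scan — the derivation forces `t^{-|Δ⁺|}`, which is how §4 states it, multiplied
out.) The `Max` is that of Proposition 1.25 (tree `AffineWeylGroupTranslationCosets`: `length_constVAdd_mul_affineHom_max`, and `max_sub_min_eq_card`
«`λ(T(d)w*) - λ(T(d)w**) = |Δ⁺|`»), so the `Max` route is the `Min` route of Proposition 1.30 shifted by `|Δ⁺|`; the involution `w ↦ w_Δ w` of `W`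
carries one onto the other, and that is how this file proves the printed statements.

THIS FILE (lane `lit-hodgefound`, prover seat p40, generation 48, row g48-#1; THEOREMS ONLY — no definition, instance, notation or named fact; net
debt 0), in the CONVENTIONS of `AffineWeylGroupPoincareSeriesClosedForm` (row g47-#9): for `g ∈ Aut P` and weights `a : Δ → ℕ`,
`a(g) := Σ_j a_j [gα_j ≺ 0]`, `b(g) := Σ_j a_j [gα_j ≻ 0]`, `n(g) := Card {α ≻ 0 | gα ≺ 0}`, `N := |Φ⁺|`; `w₀` is ANY automorphism sending `Φ⁺`
into `Φ⁻` (hypothesis `h₀ : ∀ i, b.IsPos i → ¬ b.IsPos (w₀ • i)`; the longest element of `W` is one, tree `exists_weylGroup_forall_not_isPos_smul`),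
and in §2–§4 `a_j = ⟨ϖ_j, Σ_{α≻0} α^∨⟩` are Iwahori–Matsumoto's coefficients (hypotheses `hϖ`, `ha`, as in row g47-#9, which gives `n(g) ≤ a(g)`).

* §1 (any weights `a`) ★ `isPos_mul_smul_iff_not_isPos_smul` (`w₀gα ≻ 0 ⟺ gα ≺ 0`), ★★ `card_filter_not_isPos_mul_smul_add_card_filter`
  («`n(w_Δ w) = |Δ⁺| - n(w)`», as `n(w₀g) + n(g) = N`, for EVERY `g ∈ Aut P`), ★ `sum_mul_ite_add_sum_mul_ite` («`a(w) + b(w) = a_1 + ⋯ + a_l`»),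
  ★★ `sum_mul_ite_mul_smul_eq` ∕ `sum_mul_ite_mul_smul_eq'` («`a(w_Δ w) = b(w)`», and `b(w_Δ w) = a(w)`).
* §2 ★ `card_filter_isPos_le_sum` (`N ≤ Σ_j a_j`), ★★ `sum_mul_ite_add_card_filter_eq` (`b(g) + n(g) = (a(w₀g) - n(w₀g)) + N`), ★★★
  `sub_card_filter_add_sub_card_filter_eq` (SELF-RECIPROCITY OF THE EXPONENTS: «`(a(w) - n(w)) + (a(w_Δ w) - n(w_Δ w)) = Σ_i a_i - |Δ⁺|`»), ★
  `sub_card_filter_le` (`a(g) - n(g) ≤ Σ_j a_j - N`).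
* §3 (`W` any finite set enumerating the Weyl group) ★★★ `card_filter_sub_eq_card_filter_sub_add` («`Σ_{w∈W} t^{a(w)-n(w)}` IS SELF-RECIPROCAL»,
  coefficientwise: `Card {w | a(w) - n(w) = k} = Card {w | a(w) - n(w) + k = Σ_j a_j - N}`), ★★★ `reflect_sum_X_pow_sub_card_filter` (the same for the
  polynomial `F(t) = Σ_{w∈W} t^{a(w)-n(w)} ∈ ℤ[t]`: `F.reflect (Σ_j a_j - N) = F`), ★ `natDegree_sum_X_pow_sub_card_filter_le`, ★★
  `coeff_sum_X_pow_sub_card_filter_eq_natAbs_det` (its top coefficient is `|det C| = |Ω|`, the constant term of row g47-#9), ★★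
  `natDegree_sum_X_pow_sub_card_filter` (`deg F = Σ_j a_j - N`), ★★★ `reverse_sum_X_pow_sub_card_filter` (`F.reverse = F`).
* §4 ★★ `X_pow_mul_sum_X_pow_sub_eq` (`t^N · Σ_w t^{a(w)-n(w)} = Σ_w t^{b(w)+n(w)}`), ★★★ `X_pow_mul_prod_one_sub_X_pow_mul_mk_ncard_extendedAffineWeylGroup`
  (THE `Max` FORM OF PROPOSITION 1.30 FOR `DW = Ŵ_a`, multiplied out in `ℤ⟦t⟧`: `t^N · (Π_j (1 - t^{a_j})) · Ŵ_a(t) = (Σ_w t^{n(w)}) · Σ_w t^{b(w)+n(w)}`),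
  ★★★ `natAbs_det_smul_X_pow_mul_prod_one_sub_X_pow_mul_poincareSeries` (the same for `D'W = W_a`: `|det C| · t^N · (Π_j (1 - t^{a_j})) · W_a(t) =
  (Σ_w t^{n(w)}) · Σ_w t^{b(w)+n(w)}`).

BY NAME, nothing restated: row g47-#9 (`card_filter_le_sum_mul_ite`, `prod_one_sub_X_pow_mul_mk_ncard_extendedAffineWeylGroup`,
`natAbs_det_smul_prod_one_sub_X_pow_mul_poincareSeries_affineWeylGroup`, `card_filter_sum_mul_ite_eq_card_eq_natAbs_det`), `WeylGroupFundamentalDomain`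
(`exists_weylGroup_forall_not_isPos_smul`, `isPos_smul_of_not_isPos`, `mul_self_eq_one_of_forall_not_isPos_smul`), `FundamentalWeights`
(`det_cartanMatrix_ne_zero`), `WeylGroupPoincarePolynomial` (row g37-#5: `card_filter_mul_add_card_filter_of_forall_not_isPos_smul'`, the `W`-version of
§1's complement count; here §1 is stated for every automorphism `g`); Mathlib `Polynomial.reflect`, `Polynomial.reverse`, `Finset.card_bij'`, `Finset.sum_nbij'`.

## Scope caveats

The `Max` form is DERIVED from the `Min` form of row g47-#9 through the involution `w ↦ w₀w` (the printed «similarly» re-runs the cone computation with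
`Max λ(T(d)w)`; the two routes differ by the constant `|Δ⁺|`, tree `max_sub_min_eq_card`), and is stated multiplied by `t^{|Δ⁺|}` in `ℤ⟦t⟧` (no negative
powers of `t`). Bott's form through the exponents is NOT derived. Finite reduced crystallographic root SYSTEMS over an ordered field of characteristic
zero in §2–§4 (`[P.IsRootSystem]`, fundamental weights `ϖ`, `η` with `hη` the highest co-root so that `A∘` is an alcove, as in row g47-#9); §1 for any
finite reduced crystallographic root pairing over a field of characteristic zero; the `W_a` statement of §4 for a Coxeter system `cs` on `W_a` whose
simple reflections are the walls of `A∘` (row g45-#1; it exists, `exists_coxeterSystem_affineWeylGroup`).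

## References

* [IwahoriMatsumoto1965] N. Iwahori, H. Matsumoto, Publ. Math. IHÉS 25 (1965) 5–48, §1.10, Proposition 1.30 and the paragraph following it (p. 257).
* [Humphreys1990] J. E. Humphreys, *Reflection Groups and Coxeter Groups*, CUP (1990), §1.8 (`w_∘`, `ℓ(w_∘ w) = N - ℓ(w)`), §8.9.
* [BjornerBrenti2005] A. Björner, F. Brenti, *Combinatorics of Coxeter Groups*, GTM 231, Springer (2005), §2.3 Proposition 2.3.2 (ii).
-/

noncomputable section

open Module Set Function PowerSeries
open Literature.GroupTheory.Coxeter Literature.GroupTheory.Coxeter.PreCoxeterSystem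

namespace Literature.LinearAlgebra.RootSystem

namespace Base

/-! ## §1 The involution `w ↦ w₀w`: `n(w₀w) = N - n(w)`, `a(w) + b(w) = Σ_j a_j`, `a(w₀w) = b(w)` -/

section Involution

variable {ι K M N : Type*} [Field K] [CharZero K] [AddCommGroup M] [Module K M]
  [AddCommGroup N] [Module K N] [Fintype ι]
  {P : RootPairing ι K M N} [P.IsCrystallographic] [P.IsReduced] (b : P.Base)

omit [Fintype ι] [P.IsCrystallographic] [P.IsReduced] in
/-- ★ **`w₀gα ≻ 0 ⟺ gα ≺ 0`** for `w₀` sending `Φ⁺` into `Φ⁻` (then `w₀` exchanges `Φ⁺` and `Φ⁻`, tree `isPos_smul_of_not_isPos`) and any automorphism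
`g`. [cite: IwahoriMatsumoto1965, §1.10 (p. 257, "a(w_Δ w) = b(w), n(w_Δ w) = |Δ⁺| - n(w)")] [cite: Humphreys1990, §1.8 ("w_∘ … sending Π to -Π")] -/
theorem isPos_mul_smul_iff_not_isPos_smul {w₀ : P.Aut} (h₀ : ∀ i, b.IsPos i → ¬ b.IsPos (w₀ • i)) (g : P.Aut) (i : ι) :
    b.IsPos ((w₀ * g) • i) ↔ ¬ b.IsPos (g • i) := by
  rw [mul_smul]
  exact ⟨fun h hg ↦ h₀ _ hg h, fun h ↦ isPos_smul_of_not_isPos b h₀ h⟩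

omit [Fintype ι] [P.IsCrystallographic] [P.IsReduced] in
/-- The two complementary indicators at `w₀g` and at `g`: `[w₀gα_j ≺ 0] = [gα_j ≻ 0]`. [cite: IwahoriMatsumoto1965, §1.10 (p. 257, "a(w_Δ w) = b(w)")] -/
private theorem ite_isPos_mul_smul_eq [DecidablePred b.IsPos] {w₀ : P.Aut} (h₀ : ∀ i, b.IsPos i → ¬ b.IsPos (w₀ • i)) (g : P.Aut) (i : ι)
    (x y : ℕ) : (if b.IsPos ((w₀ * g) • i) then x else y) = if b.IsPos (g • i) then y else x := by
  by_cases h : b.IsPos (g • i)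
  · rw [if_pos h, if_neg (fun h' ↦ (isPos_mul_smul_iff_not_isPos_smul b h₀ g i).1 h' h)]
  · rw [if_neg h, if_pos ((isPos_mul_smul_iff_not_isPos_smul b h₀ g i).2 h)]

omit [P.IsCrystallographic] [P.IsReduced] in
/-- ★★ **«`n(w_Δ w) = |Δ⁺| - n(w)`»**, as `n(w₀g) + n(g) = N` with `n(g) = Card {α ≻ 0 | gα ≺ 0}`, `N = |Φ⁺|`, for `w₀` sending `Φ⁺` into `Φ⁻` and
EVERY automorphism `g` of `P`: the positive roots negated by `w₀g` are exactly those kept positive by `g`. (Row g37-#5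
`card_filter_mul_add_card_filter_of_forall_not_isPos_smul'` is the case `g ∈ W`.) [cite: IwahoriMatsumoto1965, §1.10 (p. 257, "n(w_Δ w) = |Δ⁺| - n(w)")] [cite: BjornerBrenti2005, §2.3 Proposition 2.3.2 (ii) ("ℓ(w_0 w) = ℓ(w_0) - ℓ(w)")] -/
theorem card_filter_not_isPos_mul_smul_add_card_filter [DecidablePred b.IsPos] {w₀ : P.Aut} (h₀ : ∀ i, b.IsPos i → ¬ b.IsPos (w₀ • i))
    (g : P.Aut) :
    ((Finset.univ.filter b.IsPos).filter (fun i ↦ ¬ b.IsPos ((w₀ * g) • i))).card +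
      ((Finset.univ.filter b.IsPos).filter (fun i ↦ ¬ b.IsPos (g • i))).card = (Finset.univ.filter b.IsPos).card := by
  have h1 : (Finset.univ.filter b.IsPos).filter (fun i ↦ ¬ b.IsPos ((w₀ * g) • i)) =
      (Finset.univ.filter b.IsPos).filter (fun i ↦ b.IsPos (g • i)) :=
    Finset.filter_congr fun i _ ↦ by rw [isPos_mul_smul_iff_not_isPos_smul b h₀, not_not]
  rw [h1]
  exact Finset.card_filter_add_card_filter_not _

omit [Fintype ι] [P.IsCrystallographic] [P.IsReduced] in
/-- ★ **«Hence `a(w) + b(w) = a_1 + ⋯ + a_l`»**: with `a(g) = Σ_j a_j [gα_j ≺ 0]` and `b(g) = Σ_j a_j [gα_j ≻ 0]` (`Π ∩ w⁻¹Δ⁻` and `Π ∩ w⁻¹Δ⁺` partition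
`Π`), for any weights `a : Δ → ℕ` and any automorphism `g`. [cite: IwahoriMatsumoto1965, §1.10 (p. 257, "Hence a(w) + b(w) = a_1 + ⋯ + a_l")] -/
theorem sum_mul_ite_add_sum_mul_ite [DecidablePred b.IsPos] (a : b.support → ℕ) (g : P.Aut) :
    ∑ j, a j * (if b.IsPos (g • (j : ι)) then 0 else 1) + ∑ j, a j * (if b.IsPos (g • (j : ι)) then 1 else 0) = ∑ j, a j := by
  rw [← Finset.sum_add_distrib]
  exact Finset.sum_congr rfl fun j _ ↦ by split_ifs <;> simp

omit [Fintype ι] [P.IsCrystallographic] [P.IsReduced] in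
/-- ★★ **«`a(w_Δ w) = b(w)`»**: `Σ_j a_j [w₀gα_j ≺ 0] = Σ_j a_j [gα_j ≻ 0]` for `w₀` sending `Φ⁺` into `Φ⁻`, any weights `a` and any automorphism `g`.
[cite: IwahoriMatsumoto1965, §1.10 (p. 257, "a(w_Δ w) = b(w)")] -/
theorem sum_mul_ite_mul_smul_eq [DecidablePred b.IsPos] (a : b.support → ℕ) {w₀ : P.Aut} (h₀ : ∀ i, b.IsPos i → ¬ b.IsPos (w₀ • i))
    (g : P.Aut) :
    ∑ j, a j * (if b.IsPos ((w₀ * g) • (j : ι)) then 0 else 1) = ∑ j, a j * (if b.IsPos (g • (j : ι)) then 1 else 0) :=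
  Finset.sum_congr rfl fun j _ ↦ by rw [ite_isPos_mul_smul_eq b h₀ g j 0 1]

omit [Fintype ι] [P.IsCrystallographic] [P.IsReduced] in
/-- ★★ **`b(w₀g) = a(g)`** (the same with the roles exchanged: `Σ_j a_j [w₀gα_j ≻ 0] = Σ_j a_j [gα_j ≺ 0]`).
[cite: IwahoriMatsumoto1965, §1.10 (p. 257, "a(w_Δ w) = b(w)")] -/
theorem sum_mul_ite_mul_smul_eq' [DecidablePred b.IsPos] (a : b.support → ℕ) {w₀ : P.Aut} (h₀ : ∀ i, b.IsPos i → ¬ b.IsPos (w₀ • i))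
    (g : P.Aut) :
    ∑ j, a j * (if b.IsPos ((w₀ * g) • (j : ι)) then 1 else 0) = ∑ j, a j * (if b.IsPos (g • (j : ι)) then 0 else 1) :=
  Finset.sum_congr rfl fun j _ ↦ by rw [ite_isPos_mul_smul_eq b h₀ g j 1 0]

end Involution

/-! ## §2 The exponents: `b(w) + n(w) = (a(w₀w) - n(w₀w)) + N` and «`(a(w) - n(w)) + (a(w_Δ w) - n(w_Δ w)) = Σ_i a_i - |Δ⁺|`» -/

section Reciprocity

variable {ι K M N : Type*} [Field K] [LinearOrder K] [IsStrictOrderedRing K] [AddCommGroup M] [Module K M]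
  [AddCommGroup N] [Module K N] [Fintype ι] [DecidableEq ι]
  {P : RootPairing ι K M N} [CharZero K] [P.IsCrystallographic] [P.IsReduced] (b : P.Base)
  {ϖ : b.support → M} (hϖ : ∀ i j : b.support, P.coroot' j (ϖ i) = if i = j then 1 else 0)
  [Nonempty ι] [DecidablePred b.IsPos] {η : ι}
  (hη : ∀ k, P.coroot η - P.coroot k ∈ AddSubmonoid.closure (P.coroot '' (b.support : Set ι)))
  {a : b.support → ℕ} (ha : ∀ j, (a j : K) = ∑ i ∈ Finset.univ.filter b.IsPos, P.coroot' i (ϖ j))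

include hϖ hη ha

/-- ★ **`N ≤ Σ_j a_j`** (`N = |Φ⁺|`): the longest element `w₀` negates every simple root, so `a(w₀) = Σ_j a_j`, while `n(w₀) = N ≤ a(w₀)` (row g47-#9
`card_filter_le_sum_mul_ite`). Hence `Σ_j a_j - |Δ⁺|`, the degree of the self-reciprocal numerator, is an honest natural number.
[cite: IwahoriMatsumoto1965, §1.10 (p. 257, "Σ_i a_i - |Δ⁺|")] -/
theorem card_filter_isPos_le_sum : (Finset.univ.filter b.IsPos).card ≤ ∑ j, a j := by
  obtain ⟨w₀, -, h₀⟩ := exists_weylGroup_forall_not_isPos_smul b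
  have h1 := card_filter_le_sum_mul_ite b hϖ hη ha w₀
  have h2 : (Finset.univ.filter b.IsPos).filter (fun i ↦ ¬ b.IsPos (w₀ • i)) = Finset.univ.filter b.IsPos :=
    Finset.filter_true_of_mem fun i hi ↦ h₀ i (Finset.mem_filter.1 hi).2
  have h3 : ∑ j, a j * (if b.IsPos (w₀ • (j : ι)) then 0 else 1) = ∑ j, a j :=
    Finset.sum_congr rfl fun j _ ↦ by rw [if_neg (h₀ _ (b.isPos_of_mem_support j.2)), mul_one]
  rw [h2, h3] at h1
  exact h1

/-- ★★ **`b(g) + n(g) = (a(w₀g) - n(w₀g)) + N`** for `w₀` sending `Φ⁺` into `Φ⁻` and any automorphism `g` (§1: `a(w₀g) = b(g)`, `n(w₀g) = N - n(g)`;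
`n ≤ a` row g47-#9) — the exponents of the `Max` numerator `Σ_w t^{b(w)+n(w)}` are those of the `Min` numerator at `w₀w`, shifted by `|Δ⁺|`.
[cite: IwahoriMatsumoto1965, §1.10 (p. 257, "Σ_{w∈W} t^{b(w)+n(w)} … a(w_Δ w) = b(w), n(w_Δ w) = |Δ⁺| - n(w)")] -/
theorem sum_mul_ite_add_card_filter_eq {w₀ : P.Aut} (h₀ : ∀ i, b.IsPos i → ¬ b.IsPos (w₀ • i)) (g : P.Aut) :
    ∑ j, a j * (if b.IsPos (g • (j : ι)) then 1 else 0) + ((Finset.univ.filter b.IsPos).filter (fun i ↦ ¬ b.IsPos (g • i))).card =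
      (∑ j, a j * (if b.IsPos ((w₀ * g) • (j : ι)) then 0 else 1) -
          ((Finset.univ.filter b.IsPos).filter (fun i ↦ ¬ b.IsPos ((w₀ * g) • i))).card) +
        (Finset.univ.filter b.IsPos).card := by
  have h1 := card_filter_le_sum_mul_ite b hϖ hη ha (w₀ * g)
  have h2 := sum_mul_ite_mul_smul_eq b a h₀ g
  have h3 := card_filter_not_isPos_mul_smul_add_card_filter b h₀ g
  omega

/-- ★ **`N ≤ b(g) + n(g)`** (so the `Max` numerator is divisible by `t^{|Δ⁺|}`). [cite: IwahoriMatsumoto1965, §1.10 (p. 257, "Σ_{w∈W} t^{b(w)+n(w)}")] -/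
theorem card_filter_isPos_le_sum_mul_ite_add_card_filter {w₀ : P.Aut} (h₀ : ∀ i, b.IsPos i → ¬ b.IsPos (w₀ • i)) (g : P.Aut) :
    (Finset.univ.filter b.IsPos).card ≤
      ∑ j, a j * (if b.IsPos (g • (j : ι)) then 1 else 0) + ((Finset.univ.filter b.IsPos).filter (fun i ↦ ¬ b.IsPos (g • i))).card := by
  rw [sum_mul_ite_add_card_filter_eq b hϖ hη ha h₀ g]
  exact Nat.le_add_left _ _

/-- ★★★ **SELF-RECIPROCITY OF THE EXPONENTS: «`(a(w) - n(w)) + (a(w_Δ w) - n(w_Δ w)) = Σ_i a_i - |Δ⁺|`»**, for `w₀` sending `Φ⁺` into `Φ⁻` and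
EVERY automorphism `g` of `P` (§1 and `n ≤ a`, row g47-#9). [cite: IwahoriMatsumoto1965, §1.10 (p. 257, "(a(w) - n(w)) + (a(w_Δ w) - n(w_Δ w)) = Σ a_i - |Δ⁺|")] -/
theorem sub_card_filter_add_sub_card_filter_eq {w₀ : P.Aut} (h₀ : ∀ i, b.IsPos i → ¬ b.IsPos (w₀ • i)) (g : P.Aut) :
    (∑ j, a j * (if b.IsPos (g • (j : ι)) then 0 else 1) - ((Finset.univ.filter b.IsPos).filter (fun i ↦ ¬ b.IsPos (g • i))).card) +
        (∑ j, a j * (if b.IsPos ((w₀ * g) • (j : ι)) then 0 else 1) -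
          ((Finset.univ.filter b.IsPos).filter (fun i ↦ ¬ b.IsPos ((w₀ * g) • i))).card) =
      ∑ j, a j - (Finset.univ.filter b.IsPos).card := by
  have h1 := card_filter_le_sum_mul_ite b hϖ hη ha g
  have h2 := card_filter_le_sum_mul_ite b hϖ hη ha (w₀ * g)
  have h3 := sum_mul_ite_mul_smul_eq b a h₀ g
  have h4 := sum_mul_ite_add_sum_mul_ite b a g
  have h5 := card_filter_not_isPos_mul_smul_add_card_filter b h₀ g
  omega

/-- ★ **`a(g) - n(g) ≤ Σ_j a_j - N`** for every automorphism `g`: the exponents of the numerator `Σ_w t^{a(w)-n(w)}` do not exceed its degree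
`Σ_i a_i - |Δ⁺|`. [cite: IwahoriMatsumoto1965, §1.10 (p. 257, "self-reciprocal … Σ a_i - |Δ⁺|")] -/
theorem sub_card_filter_le (g : P.Aut) :
    ∑ j, a j * (if b.IsPos (g • (j : ι)) then 0 else 1) - ((Finset.univ.filter b.IsPos).filter (fun i ↦ ¬ b.IsPos (g • i))).card ≤
      ∑ j, a j - (Finset.univ.filter b.IsPos).card := by
  obtain ⟨w₀, -, h₀⟩ := exists_weylGroup_forall_not_isPos_smul b
  have h1 := sub_card_filter_add_sub_card_filter_eq b hϖ hη ha h₀ g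
  omega

/-! ## §3 «`Σ_{w∈W} t^{a(w)-n(w)}` is self-reciprocal» -/

/-- ★★★ **«`Σ_{w∈W} t^{a(w)-n(w)}` IS SELF-RECIPROCAL», COEFFICIENTWISE**: over any finite set `W` enumerating the Weyl group and for every `k`,
`Card {w ∈ W | a(w) - n(w) = k} = Card {w ∈ W | a(w) - n(w) + k = Σ_j a_j - N}` — the involution `w ↦ w₀w` of `W` exchanges the two sets (§2).
[cite: IwahoriMatsumoto1965, §1.10 (p. 257, "Σ_{w∈W} t^{a(w)-n(w)} is self-reciprocal")] -/
theorem card_filter_sub_eq_card_filter_sub_add (W : Finset P.Aut) (hW : ∀ g, g ∈ W ↔ g ∈ P.weylGroup) (k : ℕ) :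
    (W.filter (fun g ↦ ∑ j, a j * (if b.IsPos (g • (j : ι)) then 0 else 1) -
        ((Finset.univ.filter b.IsPos).filter (fun i ↦ ¬ b.IsPos (g • i))).card = k)).card =
      (W.filter (fun g ↦ ∑ j, a j * (if b.IsPos (g • (j : ι)) then 0 else 1) -
        ((Finset.univ.filter b.IsPos).filter (fun i ↦ ¬ b.IsPos (g • i))).card + k =
          ∑ j, a j - (Finset.univ.filter b.IsPos).card)).card := by
  obtain ⟨w₀, hw₀, h₀⟩ := exists_weylGroup_forall_not_isPos_smul b
  have hinv : w₀ * w₀ = 1 := mul_self_eq_one_of_forall_not_isPos_smul b hw₀ h₀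
  refine Finset.card_bij' (fun g _ ↦ w₀ * g) (fun g _ ↦ w₀ * g) ?_ ?_ ?_ ?_
  · intro g hg
    rw [Finset.mem_filter] at hg ⊢
    refine ⟨(hW _).2 (mul_mem hw₀ ((hW g).1 hg.1)), ?_⟩
    have h1 := sub_card_filter_add_sub_card_filter_eq b hϖ hη ha h₀ g
    omega
  · intro g hg
    rw [Finset.mem_filter] at hg ⊢
    refine ⟨(hW _).2 (mul_mem hw₀ ((hW g).1 hg.1)), ?_⟩
    have h1 := sub_card_filter_add_sub_card_filter_eq b hϖ hη ha h₀ g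
    have h2 := card_filter_le_sum_mul_ite b hϖ hη ha (w₀ * g)
    omega
  · intro g _
    rw [← mul_assoc, hinv, one_mul]
  · intro g _
    rw [← mul_assoc, hinv, one_mul]

omit hϖ hη ha [LinearOrder K] [IsStrictOrderedRing K] [Fintype ι] [DecidableEq ι] [CharZero K] [P.IsCrystallographic] [P.IsReduced]
  [Nonempty ι] in
/-- The coefficients of a sum of monomials `Σ_{g∈W} t^{e(g)} ∈ ℤ[t]` count the `g` with `e(g) = k`. [cite: IwahoriMatsumoto1965, §1.10 (p. 257)] -/
private theorem coeff_sum_X_pow_eq_card_filter (W : Finset P.Aut) (e : P.Aut → ℕ) (k : ℕ) :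
    (∑ g ∈ W, (Polynomial.X : Polynomial ℤ) ^ e g).coeff k = ((W.filter (fun g ↦ e g = k)).card : ℤ) := by
  rw [Polynomial.finsetSum_coeff]
  simp_rw [Polynomial.coeff_X_pow]
  rw [Finset.sum_boole]
  congr 2
  exact Finset.filter_congr fun g _ ↦ eq_comm

/-- ★★★ **«`Σ_{w∈W} t^{a(w)-n(w)}` IS SELF-RECIPROCAL», FOR THE POLYNOMIAL `F(t) = Σ_{w∈W} t^{a(w)-n(w)} ∈ ℤ[t]`**: `F.reflect (Σ_j a_j - N) = F`, i.e.
`t^{Σ_j a_j - N} F(t⁻¹) = F(t)`. [cite: IwahoriMatsumoto1965, §1.10 (p. 257, "Σ_{w∈W} t^{a(w)-n(w)} is self-reciprocal: (a(w) - n(w)) + (a(w_Δ w) - n(w_Δ w)) = Σ a_i - |Δ⁺|")] -/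
theorem reflect_sum_X_pow_sub_card_filter (W : Finset P.Aut) (hW : ∀ g, g ∈ W ↔ g ∈ P.weylGroup) :
    (∑ g ∈ W, (Polynomial.X : Polynomial ℤ) ^ (∑ j, a j * (if b.IsPos (g • (j : ι)) then 0 else 1) -
        ((Finset.univ.filter b.IsPos).filter (fun i ↦ ¬ b.IsPos (g • i))).card)).reflect (∑ j, a j - (Finset.univ.filter b.IsPos).card) =
      ∑ g ∈ W, (Polynomial.X : Polynomial ℤ) ^ (∑ j, a j * (if b.IsPos (g • (j : ι)) then 0 else 1) -
        ((Finset.univ.filter b.IsPos).filter (fun i ↦ ¬ b.IsPos (g • i))).card) := by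
  ext k
  rw [Polynomial.coeff_reflect, coeff_sum_X_pow_eq_card_filter, coeff_sum_X_pow_eq_card_filter]
  by_cases hk : k ≤ ∑ j, a j - (Finset.univ.filter b.IsPos).card
  · rw [Polynomial.revAt_le hk, card_filter_sub_eq_card_filter_sub_add b hϖ hη ha W hW k]
    congr 2
    refine Finset.filter_congr fun g _ ↦ ?_
    omega
  · have h1 : Polynomial.revAt (∑ j, a j - (Finset.univ.filter b.IsPos).card) k = k := by
      unfold Polynomial.revAt
      simp only [Function.Embedding.coeFn_mk, if_neg hk]
    rw [h1]

/-- ★ **`deg F ≤ Σ_j a_j - N`** for `F(t) = Σ_{w∈W} t^{a(w)-n(w)}` (§2 `sub_card_filter_le`). [cite: IwahoriMatsumoto1965, §1.10 (p. 257)] -/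
theorem natDegree_sum_X_pow_sub_card_filter_le (W : Finset P.Aut) :
    (∑ g ∈ W, (Polynomial.X : Polynomial ℤ) ^ (∑ j, a j * (if b.IsPos (g • (j : ι)) then 0 else 1) -
        ((Finset.univ.filter b.IsPos).filter (fun i ↦ ¬ b.IsPos (g • i))).card)).natDegree ≤
      ∑ j, a j - (Finset.univ.filter b.IsPos).card := by
  rw [Polynomial.natDegree_le_iff_coeff_eq_zero]
  intro k hk
  rw [coeff_sum_X_pow_eq_card_filter, Nat.cast_eq_zero, Finset.card_eq_zero, Finset.filter_eq_empty_iff]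
  intro g _ h
  have h1 := sub_card_filter_le b hϖ hη ha g
  omega

variable [P.IsRootSystem]

/-- ★★ **THE TOP COEFFICIENT OF `F(t) = Σ_{w∈W} t^{a(w)-n(w)}` IS `|det C|`** (`= |Ω| = [P(Φ) : Q]`): by self-reciprocity it equals the constant term,
which row g47-#9 (`card_filter_sum_mul_ite_eq_card_eq_natAbs_det`) computed from Proposition 1.30 at `t = 0`. (`cs`: a Coxeter system on `W_a` whose
simple reflections are the walls of `A∘`, row g45-#1.) [cite: IwahoriMatsumoto1965, §1.10 Proposition 1.30 and p. 257 ("self-reciprocal"), §1.7 Corollary 1.19] -/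
theorem coeff_sum_X_pow_sub_card_filter_eq_natAbs_det {M' : CoxeterMatrix (Option b.support)}
    (cs : CoxeterSystem M' (affineWeylGroup P)) (hcs : ∀ o, cs.simple o = wallReflection b η o)
    (W : Finset P.Aut) (hW : ∀ g, g ∈ W ↔ g ∈ P.weylGroup) :
    (∑ g ∈ W, (Polynomial.X : Polynomial ℤ) ^ (∑ j, a j * (if b.IsPos (g • (j : ι)) then 0 else 1) -
        ((Finset.univ.filter b.IsPos).filter (fun i ↦ ¬ b.IsPos (g • i))).card)).coeff (∑ j, a j - (Finset.univ.filter b.IsPos).card) =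
      b.cartanMatrix.det.natAbs := by
  rw [coeff_sum_X_pow_eq_card_filter, ← card_filter_sum_mul_ite_eq_card_eq_natAbs_det b hϖ hη ha cs hcs W hW]
  have h1 := card_filter_sub_eq_card_filter_sub_add b hϖ hη ha W hW 0
  simp only [add_zero] at h1
  rw [← h1]
  congr 2
  refine Finset.filter_congr fun g _ ↦ ?_
  have h2 := card_filter_le_sum_mul_ite b hϖ hη ha g
  omega

/-- ★★ **`deg F = Σ_j a_j - |Δ⁺|`** exactly (the top coefficient `|det C|` is nonzero, tree `det_cartanMatrix_ne_zero`).
[cite: IwahoriMatsumoto1965, §1.10 (p. 257, "(a(w) - n(w)) + (a(w_Δ w) - n(w_Δ w)) = Σ a_i - |Δ⁺|")] -/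
theorem natDegree_sum_X_pow_sub_card_filter {M' : CoxeterMatrix (Option b.support)}
    (cs : CoxeterSystem M' (affineWeylGroup P)) (hcs : ∀ o, cs.simple o = wallReflection b η o)
    (W : Finset P.Aut) (hW : ∀ g, g ∈ W ↔ g ∈ P.weylGroup) :
    (∑ g ∈ W, (Polynomial.X : Polynomial ℤ) ^ (∑ j, a j * (if b.IsPos (g • (j : ι)) then 0 else 1) -
        ((Finset.univ.filter b.IsPos).filter (fun i ↦ ¬ b.IsPos (g • i))).card)).natDegree =
      ∑ j, a j - (Finset.univ.filter b.IsPos).card := by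
  refine Polynomial.natDegree_eq_of_le_of_coeff_ne_zero (natDegree_sum_X_pow_sub_card_filter_le b hϖ hη ha W) ?_
  rw [coeff_sum_X_pow_sub_card_filter_eq_natAbs_det b hϖ hη ha cs hcs W hW, Nat.cast_ne_zero, ne_eq, Int.natAbs_eq_zero]
  exact det_cartanMatrix_ne_zero b

/-- ★★★ **`F.reverse = F` FOR `F(t) = Σ_{w∈W} t^{a(w)-n(w)}`**: the numerator of Proposition 1.30 is a self-reciprocal (palindromic) polynomial of
degree `Σ_j a_j - |Δ⁺|`. [cite: IwahoriMatsumoto1965, §1.10 (p. 257, "Σ_{w∈W} t^{a(w)-n(w)} is self-reciprocal")] -/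
theorem reverse_sum_X_pow_sub_card_filter {M' : CoxeterMatrix (Option b.support)}
    (cs : CoxeterSystem M' (affineWeylGroup P)) (hcs : ∀ o, cs.simple o = wallReflection b η o)
    (W : Finset P.Aut) (hW : ∀ g, g ∈ W ↔ g ∈ P.weylGroup) :
    (∑ g ∈ W, (Polynomial.X : Polynomial ℤ) ^ (∑ j, a j * (if b.IsPos (g • (j : ι)) then 0 else 1) -
        ((Finset.univ.filter b.IsPos).filter (fun i ↦ ¬ b.IsPos (g • i))).card)).reverse =
      ∑ g ∈ W, (Polynomial.X : Polynomial ℤ) ^ (∑ j, a j * (if b.IsPos (g • (j : ι)) then 0 else 1) -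
        ((Finset.univ.filter b.IsPos).filter (fun i ↦ ¬ b.IsPos (g • i))).card) := by
  rw [Polynomial.reverse, natDegree_sum_X_pow_sub_card_filter b hϖ hη ha cs hcs W hW, reflect_sum_X_pow_sub_card_filter b hϖ hη ha W hW]

/-! ## §4 The `Max` form of Proposition 1.30: `t^{|Δ⁺|} · (Π_j (1 - t^{a_j})) · P(DW, t) = P(W, t) · Σ_{w∈W} t^{b(w)+n(w)}` -/

omit [P.IsRootSystem] in
/-- ★★ **`t^N · Σ_{w∈W} t^{a(w)-n(w)} = Σ_{w∈W} t^{b(w)+n(w)}`** in `ℤ⟦t⟧` (reindex by `w ↦ w₀w`: `b(w₀w) + n(w₀w) = a(w) + (N - n(w))`, §1).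
[cite: IwahoriMatsumoto1965, §1.10 (p. 257, "Σ_{w∈W} t^{b(w)+n(w)} … a(w_Δ w) = b(w), n(w_Δ w) = |Δ⁺| - n(w)")] -/
theorem X_pow_mul_sum_X_pow_sub_eq (W : Finset P.Aut) (hW : ∀ g, g ∈ W ↔ g ∈ P.weylGroup) :
    (X : PowerSeries ℤ) ^ (Finset.univ.filter b.IsPos).card *
        ∑ g ∈ W, (X : PowerSeries ℤ) ^ (∑ j, a j * (if b.IsPos (g • (j : ι)) then 0 else 1) -
          ((Finset.univ.filter b.IsPos).filter (fun i ↦ ¬ b.IsPos (g • i))).card) =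
      ∑ g ∈ W, (X : PowerSeries ℤ) ^ (∑ j, a j * (if b.IsPos (g • (j : ι)) then 1 else 0) +
        ((Finset.univ.filter b.IsPos).filter (fun i ↦ ¬ b.IsPos (g • i))).card) := by
  obtain ⟨w₀, hw₀, h₀⟩ := exists_weylGroup_forall_not_isPos_smul b
  have hinv : w₀ * w₀ = 1 := mul_self_eq_one_of_forall_not_isPos_smul b hw₀ h₀
  rw [Finset.mul_sum]
  refine Finset.sum_nbij' (fun g ↦ w₀ * g) (fun g ↦ w₀ * g) (fun g hg ↦ (hW _).2 (mul_mem hw₀ ((hW g).1 hg)))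
    (fun g hg ↦ (hW _).2 (mul_mem hw₀ ((hW g).1 hg))) (fun g _ ↦ by rw [← mul_assoc, hinv, one_mul])
    (fun g _ ↦ by rw [← mul_assoc, hinv, one_mul]) fun g _ ↦ ?_
  rw [← pow_add]
  congr 1
  have h1 := card_filter_le_sum_mul_ite b hϖ hη ha g
  have h2 := sum_mul_ite_mul_smul_eq' b a h₀ g
  have h3 := card_filter_not_isPos_mul_smul_add_card_filter b h₀ g
  omega

/-- ★★★ **THE `Max` FORM OF PROPOSITION 1.30 FOR THE EXTENDED GROUP `DW = Ŵ_a`: «using `Max λ(T(d)w)` we get `P(DW, t) = P(W, t)/Π_{i=1}^{l}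
(1 - t^{a_i}) · t^{-|Δ⁺|} Σ_{w∈W} t^{b(w)+n(w)}`»**, multiplied out in `ℤ⟦t⟧`: `t^N · (Π_j (1 - t^{a_j})) · Ŵ_a(t) = (Σ_{g∈W} t^{n(g)}) · Σ_{g∈W}
t^{b(g)+n(g)}` with `Ŵ_a(t) = Σ_n Card {σ ∈ Ŵ_a | λ(σ) = n} t^n`, `b(g) = Σ_{gα_j ≻ 0} a_j` — from the first formula of row g47-#9 and the reindexing
`X_pow_mul_sum_X_pow_sub_eq`. [cite: IwahoriMatsumoto1965, §1.10 (p. 257, "Similarly, using Max λ(T(d)w) we get … Σ_{w∈W} t^{b(w)+n(w)} where b(w) = Σ_{α_i∈Π∩w⁻¹Δ⁺} a_i")] -/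
theorem X_pow_mul_prod_one_sub_X_pow_mul_mk_ncard_extendedAffineWeylGroup (W : Finset P.Aut) (hW : ∀ g, g ∈ W ↔ g ∈ P.weylGroup) :
    (X : PowerSeries ℤ) ^ (Finset.univ.filter b.IsPos).card * ((∏ j, (1 - (X : PowerSeries ℤ) ^ a j)) *
        PowerSeries.mk (fun n ↦ ({σ : M ≃ᵃ[K] M | σ ∈ extendedAffineWeylGroup P ∧ ∃ k : ι → ℤ,
          σ '' {x : M | ∀ i, b.IsPos i → 0 < P.coroot' i x ∧ P.coroot' i x < 1} = alcove P k ∧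
            ∑ i, |k i - (if b.IsPos i then (0 : ℤ) else -1)| = 2 * n}.ncard : ℤ))) =
      (∑ g ∈ W, (X : PowerSeries ℤ) ^ ((Finset.univ.filter b.IsPos).filter (fun i ↦ ¬ b.IsPos (g • i))).card) *
        ∑ g ∈ W, (X : PowerSeries ℤ) ^ (∑ j, a j * (if b.IsPos (g • (j : ι)) then 1 else 0) +
          ((Finset.univ.filter b.IsPos).filter (fun i ↦ ¬ b.IsPos (g • i))).card) := by
  rw [prod_one_sub_X_pow_mul_mk_ncard_extendedAffineWeylGroup b hϖ hη ha W hW, mul_left_comm, X_pow_mul_sum_X_pow_sub_eq b hϖ hη ha W hW]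

/-- ★★★ **THE `Max` FORM OF PROPOSITION 1.30 FOR THE AFFINE WEYL GROUP `D'W = W_a`**, multiplied out in `ℤ⟦t⟧` with `|Ω| = |det C|`:
`|det C| · t^N · (Π_j (1 - t^{a_j})) · W_a(t) = (Σ_{g∈W} t^{n(g)}) · Σ_{g∈W} t^{b(g)+n(g)}`, `W_a(t)` the Poincaré series (p13) of the Coxeter system
of row g45-#1 (`cs`, simple reflections = the walls of `A∘`). [cite: IwahoriMatsumoto1965, §1.10 Proposition 1.30 and p. 257 ("Similarly, using Max λ(T(d)w) …")] [cite: Humphreys1990, §8.9 (pp. 179–180)] -/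
theorem natAbs_det_smul_X_pow_mul_prod_one_sub_X_pow_mul_poincareSeries {M' : CoxeterMatrix (Option b.support)}
    (cs : CoxeterSystem M' (affineWeylGroup P)) (hcs : ∀ o, cs.simple o = wallReflection b η o)
    (W : Finset P.Aut) (hW : ∀ g, g ∈ W ↔ g ∈ P.weylGroup) :
    b.cartanMatrix.det.natAbs • ((X : PowerSeries ℤ) ^ (Finset.univ.filter b.IsPos).card *
        ((∏ j, (1 - (X : PowerSeries ℤ) ^ a j)) * poincareSeries cs ℤ (Set.univ : Set (affineWeylGroup P)))) =
      (∑ g ∈ W, (X : PowerSeries ℤ) ^ ((Finset.univ.filter b.IsPos).filter (fun i ↦ ¬ b.IsPos (g • i))).card) *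
        ∑ g ∈ W, (X : PowerSeries ℤ) ^ (∑ j, a j * (if b.IsPos (g • (j : ι)) then 1 else 0) +
          ((Finset.univ.filter b.IsPos).filter (fun i ↦ ¬ b.IsPos (g • i))).card) := by
  rw [← mul_smul_comm, natAbs_det_smul_prod_one_sub_X_pow_mul_poincareSeries_affineWeylGroup b hϖ hη ha cs hcs W hW, mul_left_comm,
    X_pow_mul_sum_X_pow_sub_eq b hϖ hη ha W hW]

end Reciprocity

end Base

end Literature.LinearAlgebra.RootSystem
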